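import Summits.CriticalPhenomena.PercolationContinuityZ3.Theses.PercShatteringRace
import Summits.CriticalPhenomena.PercolationContinuityZ3.Theorems.PercShatteringRaceNearLinearTwoClusterDecayStubPeelInclusion
import Literature.Probability.Percolation.SharpnessDCTProofs

/-!
# `NearLinearTwoClusterDecay` (stmt-CriticalPhenomena-5785), line `critical-orange-peeling`:
# restriction of shell two-cluster events to sub-shells; window form ⇒ clean form `NP_{M^L}`

The per-skin atom of the line is a statement about the shell event
`Sh(R, R')` = "the configuration restricted to the shell `Λ(R') ∖ Λ(R)` has two shell-distinct open
clusters, each joining the inner layer `Λ(R+1) ∖ Λ(R)` to `∂ⁱⁿΛ(R')`".  This file certifies the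
elementary RESTRICTION structure of these events and its consequence for the registered stub:

* `NearLinearTwoClusterDecayShellRestrict.restrict_one` / `shellTwoCluster_restrict` — for a
  lattice configuration and nested shells `N ≤ R < R' ≤ N'`:  `Sh(N, N') ⊆ Sh(R, R')` (last visit
  to `Λ(R)`, then first exit from `Λ(R')`; shell-distinctness is transported because a sub-shell
  connection closes up `u ⟷ b ⟷ b' ⟷ u'` inside the big shell).
* `real_shellTwoCluster_antitone` — hence `P_p(Sh(N, N')) ≤ P_p(Sh(R, R'))` (every `p`).
* `fixedAspectShellNonCertainty_of_window` — the WINDOW form of shell non-certainty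
  (`∃ M ≥ 2, ε > 0, L, ∀ᶠ N, ∃ ℓ < L, P(Sh(M^ℓ N, M^{ℓ+1} N)) ≤ 1 - ε`, the rev-2 registered stub)
  implies the CLEAN form at aspect `M^L` (`∃ M' ≥ 2, ε > 0, ∀ᶠ N, P(Sh(N, M' N)) ≤ 1 - ε`), since
  `Sh(N, M^L N) ⊆ Sh(M^ℓ N, M^{ℓ+1} N)` for every `ℓ < L`.  Together with the converse bridge
  (`L = 1`, in the skeleton / `…OfSparseShellNonCertainty`), the window and clean forms of the
  per-skin atom are EQUIVALENT up to the change of aspect `M ↦ M^L`: the crux's open content is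
  exactly "clean bounded-aspect shell two-cluster non-certainty at SOME aspect".

No new definitions; events are spelled inline over `box`, `innerBoundary`, `openConnIn`.
References: G. Grimmett, *Percolation* (1999), §7.4 (first-exit / last-visit path surgery).
-/

noncomputable section

open MeasureTheory Filter
open scoped Topology
open Literature.Probability.Percolation Literature.Probability.LatticeModels

namespace Summit.CriticalPhenomena.PercolationContinuityZ3.Theorems

namespace NearLinearTwoClusterDecayShellRestrict

/-- **Last visit inside an arbitrary ambient set.** An open path inside `A` from `x ∈ Λ(R)` to
`y ∉ Λ(R)` (`ω ⊆ E(ℤ³)`) has a final segment inside `A ∖ Λ(R)` starting on the layer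
`Λ(R+1) ∖ Λ(R)`. -/
theorem exists_pathIn_sdiff_box {A : Set (Site 3)} {R : ℕ} {ω : BondConfig (Site 3)}
    (hω : ω ⊆ (zdGraph 3).edgeSet) {x y : Site 3} (hxy : PathIn (openGraph ω) A x y)
    (hx : x ∈ (↑(box 3 R) : Set (Site 3))) (hy : y ∉ (↑(box 3 R) : Set (Site 3))) :
    ∃ b ∈ (↑(box 3 (R + 1)) : Set (Site 3)) \ ↑(box 3 R),
      PathIn (openGraph ω) (A \ ↑(box 3 R)) b y := by
  obtain ⟨a, b, ha, -, hb, hab, hpb⟩ := hxy.last_exit hx hy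
  exact ⟨b, ⟨Finset.mem_coe.2 (DCT16.mem_box_succ_of_adj (Finset.mem_coe.1 ha)
    (DCT16.adj_of_openGraph_adj hω hab)), hb⟩, hpb⟩

/-- **First exit inside an arbitrary ambient set.** An open path inside `A` from `x ∈ Λ(R')` to
`y ∉ Λ(R')` (`ω ⊆ E(ℤ³)`) has an initial segment inside `Λ(R') ∩ A` ending on `∂ⁱⁿΛ(R')`. -/
theorem exists_pathIn_inter_box {A : Set (Site 3)} {R' : ℕ} {ω : BondConfig (Site 3)}
    (hω : ω ⊆ (zdGraph 3).edgeSet) {x y : Site 3} (hxy : PathIn (openGraph ω) A x y)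
    (hx : x ∈ (↑(box 3 R') : Set (Site 3))) (hy : y ∉ (↑(box 3 R') : Set (Site 3))) :
    ∃ a ∈ innerBoundary (zdGraph 3) (box 3 R'),
      PathIn (openGraph ω) ((↑(box 3 R') : Set (Site 3)) ∩ A) x a := by
  obtain ⟨a, b, ha, hb, -, hab, hpa⟩ := hxy.exit hx hy
  refine ⟨a, ?_, hpa⟩
  rw [mem_innerBoundary_iff]
  exact ⟨Finset.mem_coe.1 ha, b, fun h => hb (Finset.mem_coe.2 h), DCT16.adj_of_openGraph_adj hω hab⟩

/-- **Restriction of ONE shell crossing to a sub-shell.**  For a lattice configuration, nested radii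
`N ≤ R < R' ≤ N'`, and an open path inside the shell `Λ(N') ∖ Λ(N)` from a site `u` of the inner
layer `Λ(N+1) ∖ Λ(N)` to a site `v ∈ ∂ⁱⁿΛ(N')`: there are `b ∈ Λ(R+1) ∖ Λ(R)` and
`w ∈ ∂ⁱⁿΛ(R')` with an open path inside the sub-shell `Λ(R') ∖ Λ(R)` from `b` to `w`, and `u` is
joined to `b` inside the big shell. -/
theorem restrict_one {N R R' N' : ℕ} (hNR : N ≤ R) (hRR' : R < R') (hR'N' : R' ≤ N')
    {ω : BondConfig (Site 3)} (hω : ω ⊆ (zdGraph 3).edgeSet) {u v : Site 3}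
    (hu : u ∈ (↑(box 3 (N + 1)) : Set (Site 3)) \ ↑(box 3 N))
    (hv : v ∈ innerBoundary (zdGraph 3) (box 3 N'))
    (huv : PathIn (openGraph ω) ((↑(box 3 N') : Set (Site 3)) \ ↑(box 3 N)) u v) :
    ∃ b ∈ (↑(box 3 (R + 1)) : Set (Site 3)) \ ↑(box 3 R),
      ∃ w ∈ innerBoundary (zdGraph 3) (box 3 R'),
        PathIn (openGraph ω) ((↑(box 3 R') : Set (Site 3)) \ ↑(box 3 R)) b w ∧
        PathIn (openGraph ω) ((↑(box 3 N') : Set (Site 3)) \ ↑(box 3 N)) u b := by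
  -- Step 1: last visit to `Λ(R)` (none if `N = R`)
  have step1 : ∃ b ∈ (↑(box 3 (R + 1)) : Set (Site 3)) \ ↑(box 3 R),
      PathIn (openGraph ω) ((↑(box 3 N') : Set (Site 3)) \ ↑(box 3 R)) b v ∧
      PathIn (openGraph ω) ((↑(box 3 N') : Set (Site 3)) \ ↑(box 3 N)) u b := by
    rcases Nat.eq_or_lt_of_le hNR with rfl | hlt
    · exact ⟨u, hu, huv, PathIn.refl huv.left_mem⟩
    · have huR : u ∈ (↑(box 3 R) : Set (Site 3)) :=
        Finset.mem_coe.2 (box_mono 3 (by omega) (Finset.mem_coe.1 hu.1))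
      have hvR : v ∉ (↑(box 3 R) : Set (Site 3)) := fun h =>
        DCT16.notMem_box_of_mem_innerBoundary_box (by omega) hv (Finset.mem_coe.1 h)
      obtain ⟨b, hb, hpb⟩ := exists_pathIn_sdiff_box hω huv huR hvR
      refine ⟨b, hb, hpb.mono ?_, huv.trans (hpb.mono Set.sdiff_subset).symm⟩
      rintro z ⟨⟨hz1, -⟩, hz2⟩
      exact ⟨hz1, hz2⟩
  obtain ⟨b, hb, hpb, hub⟩ := step1
  -- Step 2: first exit from `Λ(R')` (none if `R' = N'`)
  have hbR' : b ∈ (↑(box 3 R') : Set (Site 3)) :=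
    Finset.mem_coe.2 (box_mono 3 (by omega) (Finset.mem_coe.1 hb.1))
  rcases Nat.eq_or_lt_of_le hR'N' with rfl | hlt'
  · exact ⟨b, hb, v, hv, hpb, hub⟩
  · have hvR' : v ∉ (↑(box 3 R') : Set (Site 3)) := fun h =>
      DCT16.notMem_box_of_mem_innerBoundary_box hlt' hv (Finset.mem_coe.1 h)
    obtain ⟨a, ha, hpa⟩ := exists_pathIn_inter_box hω hpb hbR' hvR'
    refine ⟨b, hb, a, ha, hpa.mono ?_, hub⟩
    rintro z ⟨hz1, -, hz2⟩
    exact ⟨hz1, hz2⟩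

end NearLinearTwoClusterDecayShellRestrict

open NearLinearTwoClusterDecayShellRestrict

/-- **Shell two-cluster events restrict to sub-shells.**  For a lattice configuration `ω ⊆ E(ℤ³)`
and nested radii `N ≤ R < R' ≤ N'`:  `Sh(N, N') ⊆ Sh(R, R')` — the two big-shell crossings contain
sub-shell crossings (last visit to `Λ(R)`, first exit from `Λ(R')`), which are sub-shell-distinct
since a sub-shell connection `b ⟷ b'` would give `u ⟷ b ⟷ b' ⟷ u'` inside the big shell. -/
theorem shellTwoCluster_restrict {N R R' N' : ℕ} (hNR : N ≤ R) (hRR' : R < R') (hR'N' : R' ≤ N')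
    {ω : BondConfig (Site 3)} (hω : ω ⊆ (zdGraph 3).edgeSet)
    (h : ∃ u ∈ (↑(box 3 (N + 1)) : Set (Site 3)) \ ↑(box 3 N),
      ∃ u' ∈ (↑(box 3 (N + 1)) : Set (Site 3)) \ ↑(box 3 N),
      ∃ v ∈ innerBoundary (zdGraph 3) (box 3 N'), ∃ v' ∈ innerBoundary (zdGraph 3) (box 3 N'),
        ω ∈ openConnIn ((↑(box 3 N') : Set (Site 3)) \ ↑(box 3 N)) u v ∧
        ω ∈ openConnIn ((↑(box 3 N') : Set (Site 3)) \ ↑(box 3 N)) u' v' ∧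
        ω ∉ openConnIn ((↑(box 3 N') : Set (Site 3)) \ ↑(box 3 N)) u u') :
    ∃ b ∈ (↑(box 3 (R + 1)) : Set (Site 3)) \ ↑(box 3 R),
      ∃ b' ∈ (↑(box 3 (R + 1)) : Set (Site 3)) \ ↑(box 3 R),
      ∃ w ∈ innerBoundary (zdGraph 3) (box 3 R'), ∃ w' ∈ innerBoundary (zdGraph 3) (box 3 R'),
        ω ∈ openConnIn ((↑(box 3 R') : Set (Site 3)) \ ↑(box 3 R)) b w ∧
        ω ∈ openConnIn ((↑(box 3 R') : Set (Site 3)) \ ↑(box 3 R)) b' w' ∧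
        ω ∉ openConnIn ((↑(box 3 R') : Set (Site 3)) \ ↑(box 3 R)) b b' := by
  obtain ⟨u, hu, u', hu', v, hv, v', hv', huv, hu'v', huu'⟩ := h
  obtain ⟨b, hb, w, hw, hpbw, hub⟩ :=
    restrict_one hNR hRR' hR'N' hω hu hv (DCT16.mem_openConnIn_iff_pathIn.1 huv)
  obtain ⟨b', hb', w', hw', hpb'w', hu'b'⟩ :=
    restrict_one hNR hRR' hR'N' hω hu' hv' (DCT16.mem_openConnIn_iff_pathIn.1 hu'v')
  refine ⟨b, hb, b', hb', w, hw, w', hw', DCT16.mem_openConnIn_iff_pathIn.2 hpbw,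
    DCT16.mem_openConnIn_iff_pathIn.2 hpb'w', fun hcon => huu' ?_⟩
  have hsub : (↑(box 3 R') : Set (Site 3)) \ ↑(box 3 R) ⊆ (↑(box 3 N') : Set (Site 3)) \ ↑(box 3 N) := by
    rintro z ⟨hz1, hz2⟩
    exact ⟨Finset.mem_coe.2 (box_mono 3 hR'N' (Finset.mem_coe.1 hz1)),
      fun hz => hz2 (Finset.mem_coe.2 (box_mono 3 hNR (Finset.mem_coe.1 hz)))⟩
  have pbb' := (DCT16.mem_openConnIn_iff_pathIn.1 hcon).mono hsub
  exact DCT16.mem_openConnIn_iff_pathIn.2 ((hub.trans pbb').trans hu'b'.symm)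

/-- **Antitonicity of the shell two-cluster probability under nesting** (every `p`):
`P_p(Sh(N, N')) ≤ P_p(Sh(R, R'))` for `N ≤ R < R' ≤ N'`. -/
theorem real_shellTwoCluster_antitone (p : unitInterval) {N R R' N' : ℕ} (hNR : N ≤ R)
    (hRR' : R < R') (hR'N' : R' ≤ N') :
    (bondPercolation (zdGraph 3) p).real
        {ω | ∃ u ∈ (↑(box 3 (N + 1)) : Set (Site 3)) \ ↑(box 3 N),
          ∃ u' ∈ (↑(box 3 (N + 1)) : Set (Site 3)) \ ↑(box 3 N),
          ∃ v ∈ innerBoundary (zdGraph 3) (box 3 N'), ∃ v' ∈ innerBoundary (zdGraph 3) (box 3 N'),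
            ω ∈ openConnIn ((↑(box 3 N') : Set (Site 3)) \ ↑(box 3 N)) u v ∧
            ω ∈ openConnIn ((↑(box 3 N') : Set (Site 3)) \ ↑(box 3 N)) u' v' ∧
            ω ∉ openConnIn ((↑(box 3 N') : Set (Site 3)) \ ↑(box 3 N)) u u'} ≤
      (bondPercolation (zdGraph 3) p).real
        {ω | ∃ b ∈ (↑(box 3 (R + 1)) : Set (Site 3)) \ ↑(box 3 R),
          ∃ b' ∈ (↑(box 3 (R + 1)) : Set (Site 3)) \ ↑(box 3 R),
          ∃ w ∈ innerBoundary (zdGraph 3) (box 3 R'), ∃ w' ∈ innerBoundary (zdGraph 3) (box 3 R'),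
            ω ∈ openConnIn ((↑(box 3 R') : Set (Site 3)) \ ↑(box 3 R)) b w ∧
            ω ∈ openConnIn ((↑(box 3 R') : Set (Site 3)) \ ↑(box 3 R)) b' w' ∧
            ω ∉ openConnIn ((↑(box 3 R') : Set (Site 3)) \ ↑(box 3 R)) b b'} :=
  DCT16.real_mono_of_forall_subset_edgeSet (zdGraph 3) p
    fun _ hω h => shellTwoCluster_restrict hNR hRR' hR'N' hω h

/-- **Window form ⇒ clean form at aspect `M^L`** (every `p`; registered sub-goal of the line at
`p = p_c`).  If one of the `L` consecutive skins `Sh(M^ℓ N, M^{ℓ+1} N)`, `ℓ < L`, above every large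
`N` has probability `≤ 1 - ε`, then the single skin `Sh(N, M^L N)` of aspect `M^L` has probability
`≤ 1 - ε` for all large `N` (it restricts to each of them). -/
theorem fixedAspectShellNonCertainty_of_window (p : unitInterval)
    (h : ∃ M : ℕ, 2 ≤ M ∧ ∃ ε : ℝ, 0 < ε ∧ ∃ L : ℕ, ∀ᶠ N : ℕ in atTop, ∃ ℓ < L,
      (bondPercolation (zdGraph 3) p).real
          {ω | ∃ u ∈ (↑(box 3 (M ^ ℓ * N + 1)) : Set (Site 3)) \ ↑(box 3 (M ^ ℓ * N)),
            ∃ u' ∈ (↑(box 3 (M ^ ℓ * N + 1)) : Set (Site 3)) \ ↑(box 3 (M ^ ℓ * N)),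
            ∃ v ∈ innerBoundary (zdGraph 3) (box 3 (M ^ (ℓ + 1) * N)),
            ∃ v' ∈ innerBoundary (zdGraph 3) (box 3 (M ^ (ℓ + 1) * N)),
              ω ∈ openConnIn ((↑(box 3 (M ^ (ℓ + 1) * N)) : Set (Site 3)) \ ↑(box 3 (M ^ ℓ * N))) u v ∧
              ω ∈ openConnIn ((↑(box 3 (M ^ (ℓ + 1) * N)) : Set (Site 3)) \ ↑(box 3 (M ^ ℓ * N))) u' v' ∧
              ω ∉ openConnIn ((↑(box 3 (M ^ (ℓ + 1) * N)) : Set (Site 3)) \ ↑(box 3 (M ^ ℓ * N))) u u'}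
        ≤ 1 - ε) :
    ∃ M : ℕ, 2 ≤ M ∧ ∃ ε : ℝ, 0 < ε ∧ ∀ᶠ N : ℕ in atTop,
      (bondPercolation (zdGraph 3) p).real
          {ω | ∃ u ∈ (↑(box 3 (N + 1)) : Set (Site 3)) \ ↑(box 3 N),
            ∃ u' ∈ (↑(box 3 (N + 1)) : Set (Site 3)) \ ↑(box 3 N),
            ∃ v ∈ innerBoundary (zdGraph 3) (box 3 (M * N)),
            ∃ v' ∈ innerBoundary (zdGraph 3) (box 3 (M * N)),
              ω ∈ openConnIn ((↑(box 3 (M * N)) : Set (Site 3)) \ ↑(box 3 N)) u v ∧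
              ω ∈ openConnIn ((↑(box 3 (M * N)) : Set (Site 3)) \ ↑(box 3 N)) u' v' ∧
              ω ∉ openConnIn ((↑(box 3 (M * N)) : Set (Site 3)) \ ↑(box 3 N)) u u'}
        ≤ 1 - ε := by
  obtain ⟨M, hM, ε, hε, L, hev⟩ := h
  -- `L ≥ 1`, from any instance of the hypothesis
  obtain ⟨N₀, ℓ₀, hℓ₀, -⟩ := hev.exists
  have hL : 1 ≤ L := by omega
  have hM1 : 1 ≤ M := by omega
  refine ⟨M ^ L, le_trans hM ?_, ε, hε, ?_⟩
  · calc M = M ^ 1 := (pow_one M).symm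
      _ ≤ M ^ L := Nat.pow_le_pow_right hM1 hL
  filter_upwards [hev, eventually_ge_atTop 1] with N ⟨ℓ, hℓ, hP⟩ hN1
  refine le_trans (real_shellTwoCluster_antitone p ?_ ?_ ?_) hP
  · exact Nat.le_mul_of_pos_left N (pow_pos (by omega) ℓ)
  · have hx : 0 < M ^ ℓ * N := Nat.mul_pos (pow_pos (by omega) ℓ) (by omega)
    calc M ^ ℓ * N < 2 * (M ^ ℓ * N) := by omega
      _ ≤ M * (M ^ ℓ * N) := Nat.mul_le_mul_right _ hM
      _ = M ^ (ℓ + 1) * N := by ring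
  · exact Nat.mul_le_mul_right N (Nat.pow_le_pow_right hM1 (by omega))

/-! ## General defects: the window ⇒ clean transfer keeps ANY anchor-dependent defect -/

/-- **Window form ⇒ clean form at aspect `M^L`, for an arbitrary defect profile `δ N`** (every
`p`): if one of the `L` consecutive skins above every large anchor `N` has probability `≤ 1 - δ N`,
then `P_p(Sh(N, M^L N)) ≤ 1 - δ N` for all large `N`. -/
theorem fixedAspectShellNonCertainty_of_window_defect (p : unitInterval) (δ : ℕ → ℝ)
    (h : ∃ M : ℕ, 2 ≤ M ∧ ∃ L : ℕ, ∀ᶠ N : ℕ in atTop, ∃ ℓ < L,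
      (bondPercolation (zdGraph 3) p).real
          {ω | ∃ u ∈ (↑(box 3 (M ^ ℓ * N + 1)) : Set (Site 3)) \ ↑(box 3 (M ^ ℓ * N)),
            ∃ u' ∈ (↑(box 3 (M ^ ℓ * N + 1)) : Set (Site 3)) \ ↑(box 3 (M ^ ℓ * N)),
            ∃ v ∈ innerBoundary (zdGraph 3) (box 3 (M ^ (ℓ + 1) * N)),
            ∃ v' ∈ innerBoundary (zdGraph 3) (box 3 (M ^ (ℓ + 1) * N)),
              ω ∈ openConnIn ((↑(box 3 (M ^ (ℓ + 1) * N)) : Set (Site 3)) \ ↑(box 3 (M ^ ℓ * N))) u v ∧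
              ω ∈ openConnIn ((↑(box 3 (M ^ (ℓ + 1) * N)) : Set (Site 3)) \ ↑(box 3 (M ^ ℓ * N))) u' v' ∧
              ω ∉ openConnIn ((↑(box 3 (M ^ (ℓ + 1) * N)) : Set (Site 3)) \ ↑(box 3 (M ^ ℓ * N))) u u'}
        ≤ 1 - δ N) :
    ∃ M : ℕ, 2 ≤ M ∧ ∀ᶠ N : ℕ in atTop,
      (bondPercolation (zdGraph 3) p).real
          {ω | ∃ u ∈ (↑(box 3 (N + 1)) : Set (Site 3)) \ ↑(box 3 N),
            ∃ u' ∈ (↑(box 3 (N + 1)) : Set (Site 3)) \ ↑(box 3 N),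
            ∃ v ∈ innerBoundary (zdGraph 3) (box 3 (M * N)),
            ∃ v' ∈ innerBoundary (zdGraph 3) (box 3 (M * N)),
              ω ∈ openConnIn ((↑(box 3 (M * N)) : Set (Site 3)) \ ↑(box 3 N)) u v ∧
              ω ∈ openConnIn ((↑(box 3 (M * N)) : Set (Site 3)) \ ↑(box 3 N)) u' v' ∧
              ω ∉ openConnIn ((↑(box 3 (M * N)) : Set (Site 3)) \ ↑(box 3 N)) u u'}
        ≤ 1 - δ N := by
  obtain ⟨M, hM, L, hev⟩ := h
  obtain ⟨N₀, ℓ₀, hℓ₀, -⟩ := hev.exists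
  have hL : 1 ≤ L := by omega
  have hM1 : 1 ≤ M := by omega
  refine ⟨M ^ L, le_trans hM ?_, ?_⟩
  · calc M = M ^ 1 := (pow_one M).symm
      _ ≤ M ^ L := Nat.pow_le_pow_right hM1 hL
  filter_upwards [hev, eventually_ge_atTop 1] with N ⟨ℓ, hℓ, hP⟩ hN1
  refine le_trans (real_shellTwoCluster_antitone p ?_ ?_ ?_) hP
  · exact Nat.le_mul_of_pos_left N (pow_pos (by omega) ℓ)
  · have hx : 0 < M ^ ℓ * N := Nat.mul_pos (pow_pos (by omega) ℓ) (by omega)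
    calc M ^ ℓ * N < 2 * (M ^ ℓ * N) := by omega
      _ ≤ M * (M ^ ℓ * N) := Nat.mul_le_mul_right _ hM
      _ = M ^ (ℓ + 1) * N := by ring
  · exact Nat.mul_le_mul_right N (Nat.pow_le_pow_right hM1 (by omega))

/-- **Polylog-sparse window form ⇒ polylog-sparse CLEAN form at aspect `M^L`** (registered
sub-goal at `p = p_c`; stated for every `p`): the lead's rev-3 stub
(`∃ M ≥ 2, σ ∈ [0,1), c > 0, L, ∀ᶠ N, ∃ ℓ < L, P(Sh(M^ℓ N, M^{ℓ+1} N)) ≤ 1 - c/(log N)^σ`) is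
EQUIVALENT, up to `M ↦ M^L`, to its clean single-skin version (the converse is `L = 1`). -/
theorem sparseFixedAspectShellNonCertainty_of_sparseWindow (p : unitInterval)
    (h : ∃ M : ℕ, 2 ≤ M ∧ ∃ σ : ℝ, 0 ≤ σ ∧ σ < 1 ∧ ∃ c : ℝ, 0 < c ∧ ∃ L : ℕ,
      ∀ᶠ N : ℕ in atTop, ∃ ℓ < L,
      (bondPercolation (zdGraph 3) p).real
          {ω | ∃ u ∈ (↑(box 3 (M ^ ℓ * N + 1)) : Set (Site 3)) \ ↑(box 3 (M ^ ℓ * N)),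
            ∃ u' ∈ (↑(box 3 (M ^ ℓ * N + 1)) : Set (Site 3)) \ ↑(box 3 (M ^ ℓ * N)),
            ∃ v ∈ innerBoundary (zdGraph 3) (box 3 (M ^ (ℓ + 1) * N)),
            ∃ v' ∈ innerBoundary (zdGraph 3) (box 3 (M ^ (ℓ + 1) * N)),
              ω ∈ openConnIn ((↑(box 3 (M ^ (ℓ + 1) * N)) : Set (Site 3)) \ ↑(box 3 (M ^ ℓ * N))) u v ∧
              ω ∈ openConnIn ((↑(box 3 (M ^ (ℓ + 1) * N)) : Set (Site 3)) \ ↑(box 3 (M ^ ℓ * N))) u' v' ∧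
              ω ∉ openConnIn ((↑(box 3 (M ^ (ℓ + 1) * N)) : Set (Site 3)) \ ↑(box 3 (M ^ ℓ * N))) u u'}
        ≤ 1 - c / Real.log N ^ σ) :
    ∃ M : ℕ, 2 ≤ M ∧ ∃ σ : ℝ, 0 ≤ σ ∧ σ < 1 ∧ ∃ c : ℝ, 0 < c ∧ ∀ᶠ N : ℕ in atTop,
      (bondPercolation (zdGraph 3) p).real
          {ω | ∃ u ∈ (↑(box 3 (N + 1)) : Set (Site 3)) \ ↑(box 3 N),
            ∃ u' ∈ (↑(box 3 (N + 1)) : Set (Site 3)) \ ↑(box 3 N),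
            ∃ v ∈ innerBoundary (zdGraph 3) (box 3 (M * N)),
            ∃ v' ∈ innerBoundary (zdGraph 3) (box 3 (M * N)),
              ω ∈ openConnIn ((↑(box 3 (M * N)) : Set (Site 3)) \ ↑(box 3 N)) u v ∧
              ω ∈ openConnIn ((↑(box 3 (M * N)) : Set (Site 3)) \ ↑(box 3 N)) u' v' ∧
              ω ∉ openConnIn ((↑(box 3 (M * N)) : Set (Site 3)) \ ↑(box 3 N)) u u'}
        ≤ 1 - c / Real.log N ^ σ := by
  obtain ⟨M, hM, σ, hσ0, hσ1, c, hc, L, hev⟩ := h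
  obtain ⟨M', hM', hev'⟩ :=
    fixedAspectShellNonCertainty_of_window_defect p (fun N => c / Real.log N ^ σ) ⟨M, hM, L, hev⟩
  exact ⟨M', hM', σ, hσ0, hσ1, c, hc, hev'⟩

end Summit.CriticalPhenomena.PercolationContinuityZ3.Theorems

end
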